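import Summits.HubbardSuperconductivity.HubbardSuperconductivity.Theorems.WeakCouplingBCSKlLindhardEnclosureCrescent
import Summits.HubbardSuperconductivity.HubbardSuperconductivity.Theorems.WeakCouplingBCSKlLindhardEnclosureBdryRecords2
import Summits.HubbardSuperconductivity.HubbardSuperconductivity.Theorems.WeakCouplingBCSKlLindhardEnclosureTwoShell

/-!
# KL-MARGIN-SCAN reader (22) «kernel-lindhard-enclosure» — SINGLE-STRADDLE CELLS: the two-shell integrand is dominated by the crescent majorant

Physics side of the majorised-hyperbola rule (`Params.ceilBdry`): on a guarded grid cell inside the root square whose FAR point (`p` when the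
straddler is `p + q`, i.e. `sh = true`; `p + q` when `sh = false`) has a certified shell status `far` and certified distance floor
`Vlo = distLoZ > 0`, and on whose straddler cosine range the slope `S = 2 + 4t′a` is certified positive, the two-shell integrand at every point
of the CLOSED cell is dominated, in the cosine `b` of the straddler's second coordinate, by the crescent majorant
`cres (!far) (m x) Smin V b` of `…Crescent` (`Smin = min sDnZ/2^40`, `V = Vlo/2^40`, crescent position `m x = max(b⋆(a_x), βlo)` /
`min(b⋆(a_x), βhi)`), and the crescent extent is at most the kernel's `Lm/2^40`.  Ingredients: the closed-cell band enclosures, status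
soundness, `Literature…lindhardIntegrand_eq_ite_inv`, Gate §5 `mu_sub_band_eq` / `band_lt_iff_bStar_lt`, the records of `…BdryRecords2`
(`sDnZ`, `bStarDnZ/UpZ`, antitone `b⋆`).  Stated for `sh = true` and `sh = false` separately.  Honest framing: elementary analysis over the
landed kernel; nothing in this file asserts a KL margin at any `t′ ≠ 0`, `K₃`, `U₀`, the window or B1g dominance; a Kohn–Luttinger
instability statement is not ODLRO and nothing here proves superconductivity in the Hubbard model.  (p1 g26, 2026-08-29.)
-/

noncomputable section

set_option linter.dupNamespace false

namespace Summit.HubbardSuperconductivity.HubbardSuperconductivity.Theorems.KlLindhardEnclosure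

open Real Set MeasureTheory Literature.MathematicalPhysics.QuantumLattice
open Summit.HubbardSuperconductivity.HubbardSuperconductivity.Theorems
open Summit.HubbardSuperconductivity.HubbardSuperconductivity.Theorems.KlStair (bandR squareDispersion_eq_bandR)

/-! ## §1 The band at real coordinates; closed-cell enclosures -/

/-- `ε(pt x y) = bandR t′ (cos x) (cos y)`. -/
theorem Params.band_pt (P : Params) (x y : ℝ) :
    P.band (pt x y) = bandR ((P.tpN : ℝ) / (P.tpD : ℝ)) (Real.cos x) (Real.cos y) := by
  rw [Params.band, P.cast_tp, squareDispersion_eq_bandR, pt_apply_zero, pt_apply_one]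

/-- `ε(pt x y + q) = bandR t′ (cos (x + q₁/U)) (cos (y + q₂/U))`. -/
theorem Params.band_pt_shift (P : Params) (x y : ℝ) :
    P.band (pt x y + P.qv) = bandR ((P.tpN : ℝ) / (P.tpD : ℝ)) (Real.cos (x + (P.q1z : ℝ) / (P.U : ℝ)))
      (Real.cos (y + (P.q2z : ℝ) / (P.U : ℝ))) := by
  rw [Params.band, P.cast_tp, squareDispersion_eq_bandR, PiLp.add_apply, PiLp.add_apply, P.qv_apply_zero, P.qv_apply_one,
    pt_apply_zero, pt_apply_one]

/-- `bandR` in the kernel's polynomial form. -/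
theorem bandR_eq (t a b : ℝ) : bandR t a b = -2 * (a + b) - 4 * t * a * b := rfl

/-- **CLOSED-CELL BAND ENCLOSURE at `p`**: for `(x, y)` in the closed cell, `e1Lo/2^40 ≤ ε(pt x y) ≤ e1Hi/2^40`. -/
theorem Params.cell_band_mem_Icc (P : Params) (hP : P.admissible = true) {a b c d : ℤ} (hin : P.InRoot a b c d)
    (hg : (P.cell (P.mkX a) (P.mkX b) (P.mkY c) (P.mkY d)).guards = true) {x y : ℝ}
    (hx : x ∈ Icc ((a : ℝ) / (P.U : ℝ)) ((b : ℝ) / (P.U : ℝ))) (hy : y ∈ Icc ((c : ℝ) / (P.U : ℝ)) ((d : ℝ) / (P.U : ℝ))) :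
    (((P.cell (P.mkX a) (P.mkX b) (P.mkY c) (P.mkY d)).e1Lo : ℤ) : ℝ) / 2 ^ 40 ≤ P.band (pt x y) ∧
    P.band (pt x y) ≤ (((P.cell (P.mkX a) (P.mkX b) (P.mkY c) (P.mkY d)).e1Hi : ℤ) : ℝ) / 2 ^ 40 := by
  obtain ⟨htpD, -, hU, -, -⟩ := P.admissible_facts hP
  obtain ⟨ha, -, -, hb, hc, -, -, hd⟩ := hin
  obtain ⟨g1, g2, g3, g4, -, -, -, -⟩ := P.cell_guards _ _ _ _ hg
  obtain ⟨α1, α2⟩ := P.cell_cosx_mem hP (c := c) (d := d) ha hb hx.1 hx.2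
  obtain ⟨β1, β2⟩ := P.cell_cosy_mem hP (a := a) (b := b) hc hd hy.1 hy.2
  have key := P.band_enclosure htpD g1 g2 g3 g4 α1 α2 β1 β2
  rw [P.band_pt, bandR_eq]
  simpa [Params.cell, Params.mkX_z, Params.mkY_z] using key

/-- **CLOSED-CELL BAND ENCLOSURE at `p + q`**: `e2Lo/2^40 ≤ ε(pt x y + q) ≤ e2Hi/2^40`. -/
theorem Params.cell_band_shift_mem_Icc (P : Params) (hP : P.admissible = true) {a b c d : ℤ} (hin : P.InRoot a b c d)
    (hg : (P.cell (P.mkX a) (P.mkX b) (P.mkY c) (P.mkY d)).guards = true) {x y : ℝ}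
    (hx : x ∈ Icc ((a : ℝ) / (P.U : ℝ)) ((b : ℝ) / (P.U : ℝ))) (hy : y ∈ Icc ((c : ℝ) / (P.U : ℝ)) ((d : ℝ) / (P.U : ℝ))) :
    (((P.cell (P.mkX a) (P.mkX b) (P.mkY c) (P.mkY d)).e2Lo : ℤ) : ℝ) / 2 ^ 40 ≤ P.band (pt x y + P.qv) ∧
    P.band (pt x y + P.qv) ≤ (((P.cell (P.mkX a) (P.mkX b) (P.mkY c) (P.mkY d)).e2Hi : ℤ) : ℝ) / 2 ^ 40 := by
  obtain ⟨htpD, -, hU, -, -⟩ := P.admissible_facts hP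
  obtain ⟨ha, -, -, hb, hc, -, -, hd⟩ := hin
  obtain ⟨-, -, -, -, g1, g2, g3, g4⟩ := P.cell_guards _ _ _ _ hg
  obtain ⟨α1, α2⟩ := P.cell_cosx'_mem hP (c := c) (d := d) ha hb hx.1 hx.2
  obtain ⟨β1, β2⟩ := P.cell_cosy'_mem hP (a := a) (b := b) hc hd hy.1 hy.2
  have key := P.band_enclosure htpD g1 g2 g3 g4 α1 α2 β1 β2
  rw [P.band_pt_shift, bandR_eq]
  simpa [Params.cell, Params.mkX_z, Params.mkY_z] using key

/-! ## §2 The two elementary domination inequalities -/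

/-- Occupied side: `1/(W + S(b − b⋆)) ≤ cres true (max b⋆ lo) Smin V b` for `b⋆ ≤ b`, `lo ≤ b`, `Smin ≤ S`, `V ≤ W`. -/
theorem dom_up {S Smin V W b bs lo : ℝ} (hSmin : 0 < Smin) (hS : Smin ≤ S) (hV : 0 < V) (hVW : V ≤ W) (hbs : bs ≤ b)
    (hlo : lo ≤ b) : 1 / (W + S * (b - bs)) ≤ cres true (max bs lo) Smin V b := by
  have hm : max bs lo ≤ b := max_le hbs hlo
  simp only [cres, ↓reduceIte, indicator_of_mem (show b ∈ Ici (max bs lo) from hm)]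
  apply one_div_le_one_div_of_le
  · nlinarith
  · have h1 : Smin * (b - max bs lo) ≤ S * (b - bs) := by
      have := le_max_left bs lo
      calc Smin * (b - max bs lo) ≤ Smin * (b - bs) := by nlinarith
        _ ≤ S * (b - bs) := by nlinarith
    linarith

/-- Empty side: `1/(W + S(b⋆ − b)) ≤ cres false (min b⋆ hi) Smin V b` for `b ≤ b⋆`, `b ≤ hi`, `Smin ≤ S`, `V ≤ W`. -/
theorem dom_dn {S Smin V W b bs hi : ℝ} (hSmin : 0 < Smin) (hS : Smin ≤ S) (hV : 0 < V) (hVW : V ≤ W) (hbs : b ≤ bs)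
    (hhi : b ≤ hi) : 1 / (W + S * (bs - b)) ≤ cres false (min bs hi) Smin V b := by
  have hm : b ≤ min bs hi := le_min hbs hhi
  simp only [cres, Bool.false_eq_true, ↓reduceIte, indicator_of_mem (show b ∈ Iic (min bs hi) from hm)]
  apply one_div_le_one_div_of_le
  · nlinarith
  · have h1 : Smin * (min bs hi - b) ≤ S * (bs - b) := by
      have := min_le_left bs hi
      calc Smin * (min bs hi - b) ≤ Smin * (bs - b) := by nlinarith
        _ ≤ S * (bs - b) := by nlinarith
    linarith

/-! ## §3 Domination on a single-straddle cell -/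

/-- The crescent position used by the hyperbola rule: `far = true` (straddler EMPTY on the crescent): `min(b⋆(α), βhi)`;
`far = false` (straddler OCCUPIED on the crescent): `max(b⋆(α), βlo)`. [folklore] -/
def Params.cresPos (P : Params) (far : Bool) (βlo βhi α : ℝ) : ℝ :=
  if far then min (bStar ((P.tpN : ℝ) / (P.tpD : ℝ)) ((P.muN : ℝ) / (P.muD : ℝ)) α) βhi
  else max (bStar ((P.tpN : ℝ) / (P.tpD : ℝ)) ((P.muN : ℝ) / (P.muD : ℝ)) α) βlo

/-- **THE ABSTRACT DOMINATION STEP**: with `S(α) > 0`, far energy `|e_f| ≥ V > 0` whose occupation is `far`, straddler energy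
`ε_s = bandR t′ α b` with occupation differing from the far one or not, `Smin ≤ S(α)`, `b ∈ [βlo, βhi]`:
`F ≤ cres (!far) (cresPos far βlo βhi α) Smin V b` where `F` is the two-shell value `𝟙[occ differ]/(|e_f| + |ε_s − μ|)`. -/
theorem Params.dom_point (P : Params) (far : Bool) {α b βlo βhi Smin V ef : ℝ}
    (hS : 0 < slopeS ((P.tpN : ℝ) / (P.tpD : ℝ)) α) (hSmin : 0 < Smin) (hSminle : Smin ≤ slopeS ((P.tpN : ℝ) / (P.tpD : ℝ)) α)
    (hV : 0 < V) (hVef : V ≤ |ef - ((P.muN : ℝ) / (P.muD : ℝ))|)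
    (hfar : (ef < (P.muN : ℝ) / (P.muD : ℝ)) ↔ far = true) (hb : βlo ≤ b ∧ b ≤ βhi) :
    (if (ef < (P.muN : ℝ) / (P.muD : ℝ)) = (bandR ((P.tpN : ℝ) / (P.tpD : ℝ)) α b < (P.muN : ℝ) / (P.muD : ℝ)) then (0 : ℝ)
      else 1 / (|ef - (P.muN : ℝ) / (P.muD : ℝ)| + |bandR ((P.tpN : ℝ) / (P.tpD : ℝ)) α b - (P.muN : ℝ) / (P.muD : ℝ)|))
      ≤ cres (!far) (P.cresPos far βlo βhi α) Smin V b := by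
  set t := (P.tpN : ℝ) / (P.tpD : ℝ) with ht
  set μ := (P.muN : ℝ) / (P.muD : ℝ) with hμ
  have hkey := mu_sub_band_eq (tp := t) (μ := μ) (a := α) (b := b) hS
  split_ifs with heq
  · exact (cres_bounds (!far) hSmin.le hV b).1
  · cases far with
    | true =>
      have hf : ef < μ := hfar.mpr rfl
      have hs : ¬ bandR t α b < μ := fun h => heq (propext ⟨fun _ => h, fun _ => hf⟩)
      push Not at hs
      -- straddler empty: b ≤ b⋆
      have hle : b ≤ bStar t μ α := by
        have : slopeS t α * (b - bStar t μ α) ≤ 0 := by linarith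
        nlinarith
      have e : |bandR t α b - μ| = slopeS t α * (bStar t μ α - b) := by
        rw [abs_of_nonneg (by linarith)]; linarith
      simp only [Bool.not_true, Params.cresPos, ↓reduceIte]
      rw [e]
      exact dom_dn hSmin hSminle hV hVef hle hb.2
    | false =>
      have hf : ¬ ef < μ := fun h => by simpa using hfar.mp h
      have hs : bandR t α b < μ := by
        by_contra h; exact heq (propext ⟨fun h' => absurd h' hf, fun h' => absurd h' h⟩)
      have hlt : bStar t μ α < b := (band_lt_iff_bStar_lt hS).mp hs
      have e : |bandR t α b - μ| = slopeS t α * (b - bStar t μ α) := by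
        rw [abs_of_neg (by linarith)]; linarith
      simp only [Bool.not_false, Params.cresPos, Bool.false_eq_true, ↓reduceIte]
      rw [e]
      exact dom_up hSmin hSminle hV hVef hlt.le hb.1

/-- The two-shell integrand at a point, in the `if` form over the Fermi occupations of `p` and `p + q`. -/
theorem Params.integrand_eq_ite (P : Params) (p : Momentum) :
    P.integrand p = if (P.band p < ((P.mu : ℚ) : ℝ)) = (P.band (p + P.qv) < ((P.mu : ℚ) : ℝ)) then 0
      else 1 / (|P.band p - ((P.mu : ℚ) : ℝ)| + |P.band (p + P.qv) - ((P.mu : ℚ) : ℝ)|) := by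
  unfold Params.integrand
  rw [lindhardIntegrand_eq_ite_inv]
  by_cases h1 : P.band p < ((P.mu : ℚ) : ℝ) <;> by_cases h2 : P.band (p + P.qv) < ((P.mu : ℚ) : ℝ) <;>
    simp [fermiOccupation, h1, h2]

/-- `Smin = min(sDnZ lo, sDnZ hi)/2^40` is positive and below the slope on the straddler's cosine range. -/
theorem Params.sMin_facts (P : Params) (htpD : 0 < P.tpD) {lo hi : ℤ} (hslo : 0 < P.sDnZ lo) (hshi : 0 < P.sDnZ hi)
    {α : ℝ} (h0 : ((lo : ℤ) : ℝ) / 2 ^ 40 ≤ α) (h1 : α ≤ ((hi : ℤ) : ℝ) / 2 ^ 40) :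
    0 < ((min (P.sDnZ lo) (P.sDnZ hi) : ℤ) : ℝ) / 2 ^ 40 ∧
    ((min (P.sDnZ lo) (P.sDnZ hi) : ℤ) : ℝ) / 2 ^ 40 ≤ slopeS ((P.tpN : ℝ) / (P.tpD : ℝ)) α ∧
    0 < slopeS ((P.tpN : ℝ) / (P.tpD : ℝ)) α := by
  have hmin : 0 < min (P.sDnZ lo) (P.sDnZ hi) := lt_min hslo hshi
  have hmin' : (0 : ℝ) < ((min (P.sDnZ lo) (P.sDnZ hi) : ℤ) : ℝ) := by exact_mod_cast hmin
  have s1 := P.sDnZ_le htpD lo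
  have s2 := P.sDnZ_le htpD hi
  have s3 := (slopeS_between ((P.tpN : ℝ) / (P.tpD : ℝ)) h0 h1).1
  have hle : ((min (P.sDnZ lo) (P.sDnZ hi) : ℤ) : ℝ) / 2 ^ 40 ≤ slopeS ((P.tpN : ℝ) / (P.tpD : ℝ)) α := by
    rw [Int.cast_min, ← min_div_div_right (by positivity)]
    exact (min_le_min s1 s2).trans s3
  exact ⟨by positivity, hle, lt_of_lt_of_le (by positivity) hle⟩

/-- The same, with the roles of `p` and `p + q` listed in the other order. -/
theorem Params.integrand_eq_ite_symm (P : Params) (p : Momentum) :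
    P.integrand p = if (P.band (p + P.qv) < ((P.mu : ℚ) : ℝ)) = (P.band p < ((P.mu : ℚ) : ℝ)) then 0
      else 1 / (|P.band (p + P.qv) - ((P.mu : ℚ) : ℝ)| + |P.band p - ((P.mu : ℚ) : ℝ)|) := by
  rw [P.integrand_eq_ite]
  by_cases h1 : P.band p < ((P.mu : ℚ) : ℝ) <;> by_cases h2 : P.band (p + P.qv) < ((P.mu : ℚ) : ℝ) <;>
    simp [h1, h2, add_comm]

/-- **DOMINATION, straddler `p + q` (`sh = true`)**: at every point of the closed cell,
`F(pt x y) ≤ cres (!far) (cresPos far βlo' βhi' (cos (x + q₁/U))) Smin V (cos (y + q₂/U))`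
with `Smin = min(sDnZ aLo', sDnZ aUp')/2^40`, `V = distLoZ(e1)/2^40`, `β' = [bLo', bUp']/2^40`. -/
theorem Params.dom_sh (P : Params) (hP : P.admissible = true) {a b c d : ℤ} (hin : P.InRoot a b c d) (far : Bool)
    (hg : (P.cell (P.mkX a) (P.mkX b) (P.mkY c) (P.mkY d)).guards = true)
    (hs1 : P.status (P.cell (P.mkX a) (P.mkX b) (P.mkY c) (P.mkY d)).e1Lo (P.cell (P.mkX a) (P.mkX b) (P.mkY c) (P.mkY d)).e1Hi = some far)
    (hsLo : 0 < P.sDnZ (P.cell (P.mkX a) (P.mkX b) (P.mkY c) (P.mkY d)).aLo')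
    (hsUp : 0 < P.sDnZ (P.cell (P.mkX a) (P.mkX b) (P.mkY c) (P.mkY d)).aUp')
    (hV : 0 < P.distLoZ (P.cell (P.mkX a) (P.mkX b) (P.mkY c) (P.mkY d)).e1Lo (P.cell (P.mkX a) (P.mkX b) (P.mkY c) (P.mkY d)).e1Hi)
    {x y : ℝ} (hx : x ∈ Icc ((a : ℝ) / (P.U : ℝ)) ((b : ℝ) / (P.U : ℝ))) (hy : y ∈ Icc ((c : ℝ) / (P.U : ℝ)) ((d : ℝ) / (P.U : ℝ))) :
    P.integrand (pt x y) ≤ cres (!far)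
      (P.cresPos far ((((P.cell (P.mkX a) (P.mkX b) (P.mkY c) (P.mkY d)).bLo' : ℤ) : ℝ) / 2 ^ 40)
        ((((P.cell (P.mkX a) (P.mkX b) (P.mkY c) (P.mkY d)).bUp' : ℤ) : ℝ) / 2 ^ 40) (Real.cos (x + (P.q1z : ℝ) / (P.U : ℝ))))
      (((min (P.sDnZ (P.cell (P.mkX a) (P.mkX b) (P.mkY c) (P.mkY d)).aLo') (P.sDnZ (P.cell (P.mkX a) (P.mkX b) (P.mkY c) (P.mkY d)).aUp') : ℤ) : ℝ) / 2 ^ 40)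
      (((P.distLoZ (P.cell (P.mkX a) (P.mkX b) (P.mkY c) (P.mkY d)).e1Lo (P.cell (P.mkX a) (P.mkX b) (P.mkY c) (P.mkY d)).e1Hi : ℤ) : ℝ) / 2 ^ 40)
      (Real.cos (y + (P.q2z : ℝ) / (P.U : ℝ))) := by
  obtain ⟨htpD, hmuD, hU, -, -⟩ := P.admissible_facts hP
  obtain ⟨ha, -, -, hb, hc, -, -, hd⟩ := id hin
  obtain ⟨α1, α2⟩ := P.cell_cosx'_mem hP (c := c) (d := d) ha hb hx.1 hx.2
  obtain ⟨β1, β2⟩ := P.cell_cosy'_mem hP (a := a) (b := b) hc hd hy.1 hy.2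
  obtain ⟨hSmin, hSminle, hS⟩ := P.sMin_facts htpD hsLo hsUp α1 α2
  -- the far point `p`
  obtain ⟨e1l, e1h⟩ := P.cell_band_mem_Icc hP hin hg hx hy
  have hVef := P.distLoZ_le hmuD e1l e1h
  have hVpos : (0 : ℝ) < ((P.distLoZ (P.cell (P.mkX a) (P.mkX b) (P.mkY c) (P.mkY d)).e1Lo
      (P.cell (P.mkX a) (P.mkX b) (P.mkY c) (P.mkY d)).e1Hi : ℤ) : ℝ) / 2 ^ 40 :=
    div_pos (by exact_mod_cast hV) (by positivity)
  have hfar : (P.band (pt x y) < (P.muN : ℝ) / (P.muD : ℝ)) ↔ far = true := by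
    rw [← P.cast_mu]
    cases far with
    | true => exact ⟨fun _ => rfl, fun _ => lt_of_le_of_lt e1h (P.status_true_lt hmuD hs1)⟩
    | false => exact ⟨fun h => absurd h (not_lt.mpr ((P.status_false_le hmuD hs1).trans e1l)), fun h => by simp at h⟩
  have key := P.dom_point far hS hSmin hSminle hVpos (by rw [← P.cast_mu]; exact hVef) hfar ⟨β1, β2⟩
  rw [P.integrand_eq_ite, P.band_pt_shift, P.cast_mu]
  exact key

/-- **DOMINATION, straddler `p` (`sh = false`)**: `F(pt x y) ≤ cres (!far) (cresPos far βlo βhi (cos x)) Smin V (cos y)`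
with `Smin = min(sDnZ aLo, sDnZ aUp)/2^40`, `V = distLoZ(e2)/2^40`, `β = [bLo, bUp]/2^40`. -/
theorem Params.dom_nsh (P : Params) (hP : P.admissible = true) {a b c d : ℤ} (hin : P.InRoot a b c d) (far : Bool)
    (hg : (P.cell (P.mkX a) (P.mkX b) (P.mkY c) (P.mkY d)).guards = true)
    (hs2 : P.status (P.cell (P.mkX a) (P.mkX b) (P.mkY c) (P.mkY d)).e2Lo (P.cell (P.mkX a) (P.mkX b) (P.mkY c) (P.mkY d)).e2Hi = some far)
    (hsLo : 0 < P.sDnZ (P.cell (P.mkX a) (P.mkX b) (P.mkY c) (P.mkY d)).aLo)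
    (hsUp : 0 < P.sDnZ (P.cell (P.mkX a) (P.mkX b) (P.mkY c) (P.mkY d)).aUp)
    (hV : 0 < P.distLoZ (P.cell (P.mkX a) (P.mkX b) (P.mkY c) (P.mkY d)).e2Lo (P.cell (P.mkX a) (P.mkX b) (P.mkY c) (P.mkY d)).e2Hi)
    {x y : ℝ} (hx : x ∈ Icc ((a : ℝ) / (P.U : ℝ)) ((b : ℝ) / (P.U : ℝ))) (hy : y ∈ Icc ((c : ℝ) / (P.U : ℝ)) ((d : ℝ) / (P.U : ℝ))) :
    P.integrand (pt x y) ≤ cres (!far)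
      (P.cresPos far ((((P.cell (P.mkX a) (P.mkX b) (P.mkY c) (P.mkY d)).bLo : ℤ) : ℝ) / 2 ^ 40)
        ((((P.cell (P.mkX a) (P.mkX b) (P.mkY c) (P.mkY d)).bUp : ℤ) : ℝ) / 2 ^ 40) (Real.cos x))
      (((min (P.sDnZ (P.cell (P.mkX a) (P.mkX b) (P.mkY c) (P.mkY d)).aLo) (P.sDnZ (P.cell (P.mkX a) (P.mkX b) (P.mkY c) (P.mkY d)).aUp) : ℤ) : ℝ) / 2 ^ 40)
      (((P.distLoZ (P.cell (P.mkX a) (P.mkX b) (P.mkY c) (P.mkY d)).e2Lo (P.cell (P.mkX a) (P.mkX b) (P.mkY c) (P.mkY d)).e2Hi : ℤ) : ℝ) / 2 ^ 40)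
      (Real.cos (y + 0)) := by
  obtain ⟨htpD, hmuD, hU, -, -⟩ := P.admissible_facts hP
  obtain ⟨ha, -, -, hb, hc, -, -, hd⟩ := id hin
  obtain ⟨α1, α2⟩ := P.cell_cosx_mem hP (c := c) (d := d) ha hb hx.1 hx.2
  obtain ⟨β1, β2⟩ := P.cell_cosy_mem hP (a := a) (b := b) hc hd hy.1 hy.2
  obtain ⟨hSmin, hSminle, hS⟩ := P.sMin_facts htpD hsLo hsUp α1 α2
  -- the far point `p + q`
  obtain ⟨e2l, e2h⟩ := P.cell_band_shift_mem_Icc hP hin hg hx hy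
  have hVef := P.distLoZ_le hmuD e2l e2h
  have hVpos : (0 : ℝ) < ((P.distLoZ (P.cell (P.mkX a) (P.mkX b) (P.mkY c) (P.mkY d)).e2Lo
      (P.cell (P.mkX a) (P.mkX b) (P.mkY c) (P.mkY d)).e2Hi : ℤ) : ℝ) / 2 ^ 40 :=
    div_pos (by exact_mod_cast hV) (by positivity)
  have hfar : (P.band (pt x y + P.qv) < (P.muN : ℝ) / (P.muD : ℝ)) ↔ far = true := by
    rw [← P.cast_mu]
    cases far with
    | true => exact ⟨fun _ => rfl, fun _ => lt_of_le_of_lt e2h (P.status_true_lt hmuD hs2)⟩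
    | false => exact ⟨fun h => absurd h (not_lt.mpr ((P.status_false_le hmuD hs2).trans e2l)), fun h => by simp at h⟩
  have key := P.dom_point far hS hSmin hSminle hVpos (by rw [← P.cast_mu]; exact hVef) hfar ⟨β1, β2⟩
  rw [add_zero, P.integrand_eq_ite_symm, P.band_pt, P.cast_mu]
  exact key

/-! ## §4 The crescent extent is at most the kernel's `Lm/2^40` -/

/-- The kernel's crescent extent bound (`extB`/`extA` pattern): `ext = if occ then βUp − min(bStarDnZ lo, bStarDnZ hi)
else max(bStarUpZ lo, bStarUpZ hi) − βLo`, `Lm = max 0 (min ext (βUp − βLo))`, with `occ = !far`. [folklore] -/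
def Params.extentZ (P : Params) (far : Bool) (lo hi βLo βUp : ℤ) : ℤ :=
  max 0 (min (if (!far) then βUp - min (P.bStarDnZ lo) (P.bStarDnZ hi) else max (P.bStarUpZ lo) (P.bStarUpZ hi) - βLo) (βUp - βLo))

/-- **EXTENT BOUND**: for `α ∈ [lo, hi]/2^40` with `S > 0` certified at both ends (`sPos`), the crescent extent of `cresPos far βlo βhi α`
inside `[βLo, βUp]/2^40` is at most `extentZ/2^40`, and `0 ≤ extentZ`. -/
theorem Params.extent_le (P : Params) (hP : P.admissible = true) (far : Bool) {lo hi βLo βUp : ℤ}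
    (hslo : P.sPos lo = true) (hshi : P.sPos hi = true) {α : ℝ} (h0 : ((lo : ℤ) : ℝ) / 2 ^ 40 ≤ α) (h1 : α ≤ ((hi : ℤ) : ℝ) / 2 ^ 40) :
    0 ≤ ((P.extentZ far lo hi βLo βUp : ℤ) : ℝ) / 2 ^ 40 ∧
    cresExtentLE (!far) (P.cresPos far (((βLo : ℤ) : ℝ) / 2 ^ 40) (((βUp : ℤ) : ℝ) / 2 ^ 40) α)
      (((βLo : ℤ) : ℝ) / 2 ^ 40) (((βUp : ℤ) : ℝ) / 2 ^ 40) (((P.extentZ far lo hi βLo βUp : ℤ) : ℝ) / 2 ^ 40) := by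
  obtain ⟨htpD, hmuD, -, -, -⟩ := P.admissible_facts hP
  have htμ := P.tmu_lt_one hP
  have hSlo := P.sPos_real htpD hslo
  have hShi := P.sPos_real htpD hshi
  have hS := slopeS_pos_between ((P.tpN : ℝ) / (P.tpD : ℝ)) hSlo hShi h0 h1
  have hext0 : 0 ≤ P.extentZ far lo hi βLo βUp := by unfold Params.extentZ; exact le_max_left _ _
  refine ⟨by positivity, ?_⟩
  -- b⋆(α) between the endpoint records
  have hlo := P.le_bStarUpZ htpD hmuD hslo   -- b⋆(lo) ≤ bStarUpZ lo
  have hhi := P.bStarDnZ_le htpD hmuD hshi   -- bStarDnZ hi ≤ b⋆(hi)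
  have m1 := bStar_le_bStar htμ hSlo hS h0   -- b⋆(α) ≤ b⋆(lo)
  have m2 := bStar_le_bStar htμ hS hShi h1   -- b⋆(hi) ≤ b⋆(α)
  cases far with
  | true =>
    -- occ = false: crescent position min(b⋆, βhi); extent m − βlo
    simp only [Bool.not_true, cresExtentLE, Bool.false_eq_true, ↓reduceIte, Params.cresPos, Params.extentZ]
    push_cast
    rw [le_div_iff₀ (by positivity : (0 : ℝ) < 2 ^ 40)]
    refine le_trans ?_ (le_max_right _ _)
    have hlo' : bStar ((P.tpN : ℝ) / (P.tpD : ℝ)) ((P.muN : ℝ) / (P.muD : ℝ)) α * 2 ^ 40 ≤ ((P.bStarUpZ lo : ℤ) : ℝ) := by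
      have := m1.trans hlo; rwa [le_div_iff₀ (by positivity)] at this
    have hM : ((P.bStarUpZ lo : ℤ) : ℝ) ≤ max ((P.bStarUpZ lo : ℤ) : ℝ) ((P.bStarUpZ hi : ℤ) : ℝ) := le_max_left _ _
    have hmin1 := min_le_left (bStar ((P.tpN : ℝ) / (P.tpD : ℝ)) ((P.muN : ℝ) / (P.muD : ℝ)) α) (((βUp : ℤ) : ℝ) / 2 ^ 40)
    have hmin2 := min_le_right (bStar ((P.tpN : ℝ) / (P.tpD : ℝ)) ((P.muN : ℝ) / (P.muD : ℝ)) α) (((βUp : ℤ) : ℝ) / 2 ^ 40)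
    apply le_min
    · linarith
    · linarith
  | false =>
    simp only [Bool.not_false, cresExtentLE, ↓reduceIte, Params.cresPos, Params.extentZ]
    push_cast
    rw [le_div_iff₀ (by positivity : (0 : ℝ) < 2 ^ 40)]
    refine le_trans ?_ (le_max_right _ _)
    have hhi' : ((P.bStarDnZ hi : ℤ) : ℝ) ≤ bStar ((P.tpN : ℝ) / (P.tpD : ℝ)) ((P.muN : ℝ) / (P.muD : ℝ)) α * 2 ^ 40 := by
      have := hhi.trans m2; rwa [div_le_iff₀ (by positivity)] at this
    have hM : min ((P.bStarDnZ lo : ℤ) : ℝ) ((P.bStarDnZ hi : ℤ) : ℝ) ≤ ((P.bStarDnZ hi : ℤ) : ℝ) := min_le_right _ _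
    have hmax1 := le_max_left (bStar ((P.tpN : ℝ) / (P.tpD : ℝ)) ((P.muN : ℝ) / (P.muD : ℝ)) α) (((βLo : ℤ) : ℝ) / 2 ^ 40)
    have hmax2 := le_max_right (bStar ((P.tpN : ℝ) / (P.tpD : ℝ)) ((P.muN : ℝ) / (P.muD : ℝ)) α) (((βLo : ℤ) : ℝ) / 2 ^ 40)
    apply le_min
    · linarith
    · linarith

end Summit.HubbardSuperconductivity.HubbardSuperconductivity.Theorems.KlLindhardEnclosure

end
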